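import Literature.MathematicalPhysics.QuantumFieldTheory.Balaban1983to89.B9Eq3104CommutatorGradFormCurl
import Literature.MathematicalPhysics.QuantumFieldTheory.Balaban1983to89.B6GradLegKLevelV1

/-!
# `Balaban1983to89.B9Eq371HessianSplitY` — [B9] (3.70)–(3.71) p. 404 AT def-Y'S LETTERS, THE IDENTITIES: the flat curl is first order in the flat bond
# derivatives (`D₁ = Σ_μ sel_μ∘∇_μ`), the covariant-minus-flat curl is `c_f` times a ZEROTH-ORDER letter (`D_V − D₁ = c_f·K_V`, (3.70)), and the
# FOUR-TERM SPLIT of the Hessian difference `Δ(1) − Δ(V) = A + B₁ + B₂ + C` that organises the proof of (3.73) (sub-row G-B9-LETTERS, module M5.1b-G,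
# FILE G-F5a part I; no estimates here)

T. Bałaban, *Propagators for lattice gauge theories in a background field*, Commun. Math. Phys. **99** (1985) 389–434
[`Balaban1985BackgroundPropagators`, "B9"].

statement-level skeleton of published theorems with citation tags; proofs where landed; nothing here is a claim about the
Yang–Mills mass gap

THE PRINTED LOCUS (verbatim, held `paper:balaban1985-cmp99-background-propagators` p0016–p0017 = pp. 404–405).  p. 404: *«Thus we have to investigate only an
expansion of the operator D\*_{U′U}D_{U′U}. We do it in a way similar to (3.50)–(3.53) … (D_{U′U}A′)_{μν}(x) = (D_UA′)_{μν}(x) + η⁻¹(exp ηi ad_{A_μ(x)} − 1)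
R(U(x, x+ηe_μ))A′_ν(x+ηe_μ) − η⁻¹(exp ηi ad_{A_ν(x)} − 1)R(U(x, x+ηe_ν))A′_μ(x+ηe_ν), (3.70) … = (D\*DA′)_μ(x) − (V₁(A)A′)_μ(x). (3.71)»*; p. 405:
*«The operator V₁ satisfies |(V₁(A)A′)(b)| ≦ O(1)(…) ≦ O(1)α₁((Lʲη)⁻¹|∇_UA′| + (Lʲη)⁻²|A′|), b ∈ Ω_j, (3.73) … The derivatives are, of course, the covariant
derivatives defined by U.»*  Here `U = 1` (Cor. 3.6's cube road: `G_□(Ṽ_□)` is expanded around `G_□(1)`), so the derivatives are the FLAT `∇_μ`.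

WHY THIS FILE (cell `lit-balaban`, sub-row G-B9-LETTERS; module M5.1b-G after the assembly G-F5 `B9Cor35GAtCubeLetters` p645320 ✓).  The assembly's one open
analytic input on the Laplacian side is `hLap : lapPieceK b i Ṽ = V⁰ + Σ_ν V¹_ν·DK b i ν` with (3.73)-shaped majorants of `V⁰`, `V¹_ν` — the realification of an
operator identity `Δ(1) − Δ(Ṽ) = V⁰ + Σ_μ V¹_μ∘∇_μ` at def-Y's Hessian `hessY V = coCurlY V ∘ jordanY V ∘ curlY V + curv2Y V`.  THIS FILE lands the letter-level
identities such a decomposition starts from: the flat bond derivative `∇_μ` (= def-Y's `cdB 1 μ` = the lift of r03's `DV μ c_f`, the core of G-F4's `DK`), the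
direction selectors with `D₁ = Σ_μ sel_μ∘∇_μ`, the zeroth-order letter `K_V` with `D_V − D₁ = c_f·K_V` ((3.70), `R(V) − 1` kept exact — print expands
`R(U′) = 1 + ηi ad_A + …`), and the split `Δ(1) − Δ(V) = −(D*_V𝒦_V − D*₁)∘D₁ − c_f·D*₁∘K_V − c_f·(D*_V𝒦_V − D*₁)∘K_V − Δ′₂(V)`: the first term is already of the
form `Σ_μ W_μ∘∇_μ`; the third is a product of two small factors and the fourth the curvature commutator (both `V⁰`-sized under the (3.37) windows); the second —
the FLAT co-curl of a zeroth-order word — is the one that needs the output-side product rule of (3.71)'s second equality (part II).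

WHAT THIS FILE PROVES (THEOREMS + `def`s with bodies; 0 `def … : Prop`, 0 sorry).  §1 `nablaY i μ := liftEndY 𝔸 (DV μ c_f)`, `nablaY_apply`, ★ `cdB_one_eq_nablaY`
(`cdB i 1 μ = ∇_μ`), `selY i μ` (+ `selY_apply`), ★★ `curlY_one_eq_sum` (`curlY i 1 = Σ_μ selY i μ ∘ₗ nablaY i μ`).  §2 `KY i V` (+ `KY_apply`), ★★ `curlY_sub_curlY_one`
(`curlY i V − curlY i 1 = c_f • KY i V`), ★★ `hessY_one_sub_hessY_split` (the four-term split above, an identity of `ℂ`-linear maps).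

HONEST SCOPE.  Identities only (def-Y's letters `curlY`/`coCurlY`/`jordanY`/`curv2Y`/`hessY`/`cdB`, `jordanY_one`, `curv2Y_one`, p38's `curlY_apply_eq`, r03's `DV`);
no estimate, no window, no majorant — those are part II ∕ the estimates file of G-F5a.  Count-neutral; NOT a node discharge; no summit ∕ sub-problem statement is
proved; nothing continuum ∕ OS ∕ mass-gap ∕ Clay; YM mass gap NOT proved by any of this (Track A conditional rung).  No `sorry`, no `axiom`, no `… : Prop` fact, no
`instance`, no `notation`.  NEW file; nothing landed is modified.  Cell `lit-balaban`, seat `lit-balaban-p38` gen 42, 2026-08-28; `--supports stmt-QuantumFields-19200`.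
Net new unproved facts: 0.

RELATED IN THE TREE, NOT DUPLICATED: def-Y `Node00.OpsYDeltaA.curlY_one`/`coCurlY_one`/`hessY_one` (the `U = 1` letters as matrix lifts; here `D₁` is re-expressed
through `∇_μ`), p38's `B9Eq3104CommutatorGradFormCurl.curlY_apply_eq` ((3.4) pointwise, used); r06's (3.70)–(3.73) at the torus letters of its own ladder
(`B9Eq370Expansion`, `B9Eq371Composition`, `B9Eq371GradLetters`, `B9Eq372Operator` — other carriers, print's `exp ηi ad_A` expansion); cell `pub-balaban` t4's
pointwise Leibniz split of the principal part for abstract transporters (`B9Eq371BondPrincipalTwoBackgroundSplit.norm_covLapPrincipal_sub_flat_apply_le`, carriers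
`B9Eq34CovCurlVector`; no `𝒦`-insertion, no `Δ′`) — the model for part II's output-side product rule, at other letters.
-/

noncomputable section

namespace Literature.MathematicalPhysics.QuantumFieldTheory.Balaban1983to89.B9Eq371HessianSplitY

open Node00
open Literature.MathematicalPhysics.QuantumFieldTheory.Balaban1983to89
open Literature.MathematicalPhysics.QuantumFieldTheory.Balaban1983to89.B6KLevelCensusIndexV1 (KIdx)
open Literature.MathematicalPhysics.QuantumFieldTheory.Balaban1983to89.B6GlobalChartV1 (PV)
open Literature.MathematicalPhysics.QuantumFieldTheory.Balaban1983to89.B6GradLegKLevelV1 (DV DV_apply)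
open Literature.MathematicalPhysics.QuantumFieldTheory.Balaban1983to89.B9Eq39Adjoint (R)
open Literature.MathematicalPhysics.QuantumFieldTheory.Balaban1983to89.B9BackgroundsKLevelV1 (shiftsV1)
open Literature.MathematicalPhysics.QuantumFieldTheory.Balaban1983to89.B9Eq3104CommutatorGradFormCurl (curlY_apply_eq)
open scoped Matrix

variable {d ℓ : ℕ} {hd : 1 ≤ d + 1} {hL : Odd (ℓ + 1) ∧ 1 < ℓ + 1} {b₀ b₁ : ℝ}
variable {𝔸 : Type} [NormedRing 𝔸] [NormedAlgebra ℂ 𝔸] [CompleteSpace 𝔸]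
variable (i : KIdx d ℓ hd hL b₀ b₁)

/-! ## §1  The flat bond derivative `∇_μ = c_f(S_μ − 1)` as a letter, the direction selectors, and `D₁ = Σ_μ sel_μ ∘ ∇_μ` -/

/-- **the FLAT FORWARD DERIVATIVE of bond functions in direction `μ`**, `(∇_μX)(⟨x, ν⟩) = c_f·(X(⟨x+e_μ, ν⟩) − X(⟨x, ν⟩))` — the `ℂ`-linear lift of r03's `DV μ c_f`
(the core of G-F4's realified `DK`). [cite: Balaban1985BackgroundPropagators, (3.3) p.390 at U = 1, p.395; Balaban1984PropagatorsII, (2.136) p.247] -/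
abbrev nablaY (μ : Fin (d + 1)) : (FBondY i → 𝔸) →ₗ[ℂ] (FBondY i → 𝔸) := liftEndY 𝔸 (DV (P := PV d ℓ i.m i.K hd hL) μ i.cf)

omit [CompleteSpace 𝔸] in
/-- `∇_μ` evaluated. [cite: Balaban1984PropagatorsI, (1.4) p.18] -/
theorem nablaY_apply (μ : Fin (d + 1)) (X : FBondY i → 𝔸) (b : FBondY i) :
    nablaY i μ X b = ((i.cf : ℝ) : ℂ) • (X ⟨b.src.shift μ, b.dir⟩ - X b) := by
  classical
  rw [nablaY, liftEndY]
  simp only [liftOpY, LinearMap.coe_mk, AddHom.coe_mk]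
  have e : ∀ b' : FBondY i, LinearMap.toMatrix' (DV (P := PV d ℓ i.m i.K hd hL) μ i.cf) b b' =
      i.cf * ((if (⟨b.src.shift μ, b.dir⟩ : FBondY i) = b' then 1 else 0) - if b = b' then 1 else 0) := by
    intro b'
    rw [LinearMap.toMatrix'_apply, DV_apply]
    simp only [Pi.single_apply]
  simp_rw [e, Complex.ofReal_mul, Complex.ofReal_sub, mul_smul, ← Finset.smul_sum, sub_smul, Finset.sum_sub_distrib]
  congr 1
  simp only [apply_ite Complex.ofReal, Complex.ofReal_one, Complex.ofReal_zero, ite_smul, one_smul, zero_smul,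
    Finset.sum_ite_eq, Finset.mem_univ, if_true]

/-- def-Y's `∇_{1,μ}` on the bond sector IS `∇_μ`. [cite: Balaban1985BackgroundPropagators, p.395] -/
theorem cdB_one_eq_nablaY (μ : Fin (d + 1)) (X : FBondY i → 𝔸) : cdB i (fun _ _ => 1) μ X = nablaY i μ X := by
  funext b
  rw [cdB_one, nablaY_apply]
  rfl


/-- **the direction selector `sel_μ : bond functions → plaquette functions`**, `(sel_μY)(p_{μ′ν′}(x)) = [μ′ = μ]·Y(⟨x, ν′⟩) − [ν′ = μ]·Y(⟨x, μ′⟩)` — so that the flat curl is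
`D₁ = Σ_μ sel_μ ∘ ∇_μ` ((3.4) at `U = 1`: `(D₁X)(p_{μν}(x)) = (∇_μX)(⟨x,ν⟩) − (∇_νX)(⟨x,μ⟩)`). [cite: Balaban1985BackgroundPropagators, (3.4) p.391] -/
def selY (μ : Fin (d + 1)) : (FBondY i → 𝔸) →ₗ[ℂ] (PlaqY i → 𝔸) where
  toFun Y := fun p => (if p.μ = μ then Y ⟨p.src, p.ν⟩ else 0) - (if p.ν = μ then Y ⟨p.src, p.μ⟩ else 0)
  map_add' Y Y' := by
    funext p
    simp only [Pi.add_apply]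
    split_ifs <;> abel
  map_smul' c Y := by
    funext p
    simp only [Pi.smul_apply, RingHom.id_apply, smul_sub, smul_ite, smul_zero]

omit [CompleteSpace 𝔸] in
/-- `sel_μ` evaluated. [cite: Balaban1985BackgroundPropagators, (3.4) p.391, bookkeeping] -/
theorem selY_apply (μ : Fin (d + 1)) (Y : FBondY i → 𝔸) (p : PlaqY i) :
    selY i μ Y p = (if p.μ = μ then Y ⟨p.src, p.ν⟩ else 0) - (if p.ν = μ then Y ⟨p.src, p.μ⟩ else 0) := rfl

/-- ★ **THE FLAT CURL IS FIRST ORDER IN THE FLAT BOND DERIVATIVES**: `D₁ = Σ_μ sel_μ ∘ ∇_μ`. [cite: Balaban1985BackgroundPropagators, (3.4) p.391 at U = 1] -/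
theorem curlY_one_eq_sum : curlY i (fun _ _ => (1 : 𝔸ˣ)) = ∑ μ, selY i μ ∘ₗ nablaY i μ := by
  refine LinearMap.ext fun X => funext fun p => ?_
  rw [curlY_apply_eq, cdB_one_eq_nablaY, cdB_one_eq_nablaY, LinearMap.coe_sum, Finset.sum_apply, Finset.sum_apply]
  simp only [LinearMap.comp_apply, selY_apply, Finset.sum_sub_distrib, Finset.sum_ite_eq, Finset.mem_univ, if_true]

/-! ## §2  (3.70): `D_V − D₁ = c_f·K_V` with the ZEROTH-ORDER letter `K_V`, and the four-term split of `Δ(1) − Δ(V)` -/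

/-- **the zeroth-order letter `K_V` of (3.70)**: `(K_VX)(p_{μν}(x)) = (R(V_μ(x)) − 1)X(⟨x+e_μ, ν⟩) − (R(V_ν(x)) − 1)X(⟨x+e_ν, μ⟩)` (print: the `η i ad_A`-terms
of `D_{U′U} − D_U` before the expansion `R(U′) = 1 + ηi ad_A + …`; here exact, `R(V) − 1` unexpanded). [cite: Balaban1985BackgroundPropagators, (3.70) p.404] -/
def KY (V : CfgY 𝔸 i) : (FBondY i → 𝔸) →ₗ[ℂ] (PlaqY i → 𝔸) where
  toFun X := fun p =>
    (R (V p.μ p.src) (X ⟨p.src.shift p.μ, p.ν⟩) - X ⟨p.src.shift p.μ, p.ν⟩) -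
      (R (V p.ν p.src) (X ⟨p.src.shift p.ν, p.μ⟩) - X ⟨p.src.shift p.ν, p.μ⟩)
  map_add' X X' := by
    funext p
    simp only [Pi.add_apply, B9Eq39Adjoint.R_add]
    abel
  map_smul' c X := by
    funext p
    simp only [Pi.smul_apply, B9Eq39Adjoint.R_smul, RingHom.id_apply, smul_sub]

/-- `K_V` evaluated. [cite: Balaban1985BackgroundPropagators, (3.70) p.404, bookkeeping] -/
theorem KY_apply (V : CfgY 𝔸 i) (X : FBondY i → 𝔸) (p : PlaqY i) :
    KY i V X p = (R (V p.μ p.src) (X ⟨p.src.shift p.μ, p.ν⟩) - X ⟨p.src.shift p.μ, p.ν⟩) -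
      (R (V p.ν p.src) (X ⟨p.src.shift p.ν, p.μ⟩) - X ⟨p.src.shift p.ν, p.μ⟩) := rfl

/-- ★ **(3.70) AS AN OPERATOR IDENTITY**: `D_V − D₁ = c_f·K_V`. [cite: Balaban1985BackgroundPropagators, (3.70) p.404, (3.4) p.391] -/
theorem curlY_sub_curlY_one (V : CfgY 𝔸 i) : curlY i V - curlY i (fun _ _ => 1) = ((i.cf : ℝ) : ℂ) • KY i V := by
  refine LinearMap.ext fun X => funext fun p => ?_
  rw [LinearMap.sub_apply, Pi.sub_apply, curlY_apply_eq, curlY_apply_eq, cdB_one, cdB_one, LinearMap.smul_apply, Pi.smul_apply, KY_apply]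
  simp only [cdB, B9Eq39Adjoint.covD, smul_sub]
  simp only [B9BackgroundsKLevelV1.shiftsV1, LatticeFieldCalculus.shiftEquiv, Equiv.coe_fn_mk, Site.shift]
  abel

/-- ★★ **THE FOUR-TERM SPLIT OF THE HESSIAN DIFFERENCE** (print's (3.71) before the expansion of `R(U′)`): `Δ(1) − Δ(V) = A + B₁ + B₂ + C` with
`A := −(D*_V𝒦_V − D*₁) ∘ Σ_μ sel_μ∇_μ` (first order: the `V¹·∇` words), `B₁ := −c_f·D*₁ ∘ K_V` (FLAT co-curl of a zeroth-order word — the term needing the output-side product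
rule, (3.71) 2nd equality), `B₂ := −c_f·(D*_V𝒦_V − D*₁) ∘ K_V` (product of two small factors), `C := −Δ′₂(V)` (the curvature commutator (3.10), zero at `V = 1`).
[cite: Balaban1985BackgroundPropagators, (3.70)–(3.71) pp.404–405, (3.10) p.392] -/
theorem hessY_one_sub_hessY_split (V : CfgY 𝔸 i) :
    hessY i (fun _ _ => 1) - hessY i V =
      -((coCurlY i V ∘ₗ jordanY i V - coCurlY i (fun _ _ => 1)) ∘ₗ ∑ μ, selY i μ ∘ₗ nablaY i μ) -
        ((i.cf : ℝ) : ℂ) • (coCurlY i (fun _ _ => 1) ∘ₗ KY i V) -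
        ((i.cf : ℝ) : ℂ) • ((coCurlY i V ∘ₗ jordanY i V - coCurlY i (fun _ _ => 1)) ∘ₗ KY i V) - curv2Y i V := by
  have h1 : hessY i (fun _ _ => 1) - hessY i V =
      -((coCurlY i V ∘ₗ jordanY i V - coCurlY i (fun _ _ => 1)) ∘ₗ curlY i (fun _ _ => 1)) -
        coCurlY i V ∘ₗ jordanY i V ∘ₗ (curlY i V - curlY i (fun _ _ => 1)) - curv2Y i V := by
    rw [hessY, hessY, jordanY_one, curv2Y_one]
    simp only [LinearMap.comp_sub, LinearMap.sub_comp, LinearMap.id_comp, add_zero, LinearMap.comp_assoc]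
    abel
  rw [h1, curlY_sub_curlY_one, ← curlY_one_eq_sum]
  simp only [LinearMap.comp_smul, LinearMap.sub_comp, LinearMap.comp_assoc, smul_sub]
  abel

end Literature.MathematicalPhysics.QuantumFieldTheory.Balaban1983to89.B9Eq371HessianSplitY

end
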